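import Summits.Ventures.Crystal3D.Theorems.StickyWulffConstantCoaxialWallLawSharpTransCellGeneric
import Summits.Ventures.Crystal3D.Theorems.StickyWulffConstantCoaxialWallLawPayerAssembly
import Summits.Ventures.Crystal3D.Theorems.StickyWulffConstantCoaxialWallLawSkewAxis
import HarnessLib

/-!
# Sharp end accounting, translation pairs with a 3-adically GENERIC offset: orientation-free charge `½`
# (modulo the named census facts)

HONEST FRAMING. Part of the venture `Summits/Ventures/Crystal3D` (cell `crystal3d-full`), helper
`--supports` the crux `CoaxialWallLaw` (stmt-Ventures-19481, `route-Ventures-StickyWulffConstant`),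
REGISTERED line `WallLedgerF` (planner cf-p1 gen 16), open stub `stub_coaxialTwoSlabAdhesion`.
RUNG CREDIT ONLY (conditional).  Companion of `…SharpTrans` (skew root / skew offset): the text of
`translate_twoSlabAdhesion_generic_exact` (`…ExactTrans`, `1/44`) with the sharp generic cell
`wordNet_trans_payers_ge_generic_sharp` (`…SharpTransCellGeneric`) and the deficit assembly
`twoSlab_cross_le_of_deficit` (`…PayerAssembly`): the root is the steepest slot (rise `≥ 1/√2`, `exists_slot_rise_ge`
of `…SkewAxis`), each reachable line end consumes its own missing contact, so the charge is `½` WHATEVER the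
orientation — at least the crux's `½·sin θ` for every axis.  INPUTS BY NAME: `KissingGap δ` (`δ > 0`, `δ² > 16/3`),
the E1 rows C12-55 (`hcert`) / A12 glide star (`hcertA`), the census target `KFoldTopDeficit`.

WHAT THIS IS NOT: not the stub unconditionally; F-C1 not moved.
-/

noncomputable section

namespace Summit.Ventures.Crystal3D.Theorems

open Summit.Ventures.Crystal3D Finset
open Literature.MathematicalPhysics.StatisticalMechanics (fccStacking barlowStacking IsHaggSeq
  contactDeficiency)
open scoped InnerProductSpace

section Exact

variable {δ : ℝ} (hg : KissingGap δ) (hδ0 : 0 < δ) (hδ : 16 / 3 < δ ^ 2) (hK : KFoldTopDeficit)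
  {s₀ : EuclideanSpace ℝ (Fin 3)} (hs₀ : s₀ ∈ fccSlots)
  (hcert : ExactOnly 0 (fccSlots.filter fun w => 0 < ⟪w, s₀⟫_ℝ))
  (hcertA : ∀ (A : EuclideanSpace ℝ (Fin 3) ≃ₗᵢ[ℝ] EuclideanSpace ℝ (Fin 3)) (n : EuclideanSpace ℝ (Fin 3)),
    ‖n‖ = 1 → (∀ w ∈ fccSlots, ⟪A w, n⟫_ℝ = 0 ∨ ⟪A w, n⟫_ℝ = Real.sqrt (2 / 3) ∨ ⟪A w, n⟫_ℝ = -Real.sqrt (2 / 3)) →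
    ∀ u ∈ fccSlots, ⟪A u, n⟫_ℝ = 0 → ∀ b : EuclideanSpace ℝ (Fin 3),
    ExactOnly b (insert (b - A u)
      (((fccSlots.filter fun s => ⟪s, u⟫_ℝ = -(1 / 2) ∧ ⟪A (u + s), n⟫_ℝ ≤ 0).image (fun s => b + A s)) ∪
        ((fccSlots.filter fun s => ⟪s, u⟫_ℝ = -(1 / 2) ∧ ⟪A (u + s), n⟫_ℝ < 0).image
          (fun s => b + (A s - (2 * ⟪A s, n⟫_ℝ) • n))))))
include hg hδ0 hδ hK hs₀ hcert hcertA

open scoped Classical in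
/-- **The sharp rung for TRANSLATION pairs with a 3-adically generic offset**: ORIENTATION-FREE charge `½`
(root = the steepest slot, rise `≥ 1/√2`; census facts by name).  See the module docstring. -/
theorem translate_twoSlabAdhesion_generic_sharp
    (A₁ : EuclideanSpace ℝ (Fin 3) ≃ₗᵢ[ℝ] EuclideanSpace ℝ (Fin 3)) (t₁ : EuclideanSpace ℝ (Fin 3))
    (A₂ : EuclideanSpace ℝ (Fin 3) ≃ₗᵢ[ℝ] EuclideanSpace ℝ (Fin 3)) (t₂ : EuclideanSpace ℝ (Fin 3))
    (htrans : A₁ '' fccStacking 1 (Real.sqrt (2 / 3)) = A₂ '' fccStacking 1 (Real.sqrt (2 / 3)))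
    (hgen : ∀ k : ℕ, ((3 : ℝ) ^ k) • A₁.symm (t₂ - t₁) ∉ fccStacking 1 (Real.sqrt (2 / 3))) :
    ∃ C R₀ : ℝ, 1 ≤ R₀ ∧ ∀ h : ℝ, 0 ≤ h → ∀ ρ : ℝ, R₀ ≤ ρ →
      ∀ X P₁ P₂ : Finset (EuclideanSpace ℝ (Fin 3)),
      (∀ p ∈ X, ∀ q ∈ X, p ≠ q → 1 ≤ dist p q) → P₁ ⊆ X → P₂ ⊆ X \ P₁ →
      (∀ p ∈ X, -(2 * R₀) ≤ p 2 ∧ p 2 ≤ h + 2 * R₀ ∧ p 0 ^ 2 + p 1 ^ 2 ≤ ρ ^ 2) →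
      (∀ p, p ∈ P₁ ↔ (p ∈ (fun q => A₁ q + t₁) '' fccStacking 1 (Real.sqrt (2 / 3)) ∧
        -(2 * R₀) ≤ p 2 ∧ p 2 ≤ -R₀ ∧ p 0 ^ 2 + p 1 ^ 2 ≤ ρ ^ 2)) →
      (∀ p, p ∈ P₂ ↔ (p ∈ (fun q => A₂ q + t₂) '' fccStacking 1 (Real.sqrt (2 / 3)) ∧
        h + R₀ ≤ p 2 ∧ p 2 ≤ h + 2 * R₀ ∧ p 0 ^ 2 + p 1 ^ 2 ≤ ρ ^ 2)) →
      ((((P₁ ×ˢ (X \ P₁)).filter fun pq => dist pq.1 pq.2 = 1).card : ℕ) : ℝ) +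
        ((((P₂ ×ˢ ((X \ P₁) \ P₂)).filter fun pq => dist pq.1 pq.2 = 1).card : ℕ) : ℝ) ≤
        contactDeficiency ((X \ P₁) \ P₂) +
          (Real.sqrt 2 / 4 * ∑ᶠ w ∈ {w ∈ fccStacking 1 (Real.sqrt (2 / 3)) | ‖w‖ = 1},
              |⟪w, A₁.symm (EuclideanSpace.single (2 : Fin 3) (1 : ℝ))⟫_ℝ| +
            Real.sqrt 2 / 4 * ∑ᶠ w ∈ {w ∈ fccStacking 1 (Real.sqrt (2 / 3)) | ‖w‖ = 1},
              |⟪w, A₂.symm (EuclideanSpace.single (2 : Fin 3) (1 : ℝ))⟫_ℝ| - (1 / 2 : ℝ)) * Real.pi * ρ ^ 2 +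
          C * (1 + h) * ρ := by
  -- the top grain in the bottom frame
  have hΛ₂ : (fun q => A₂ q + t₂) '' fccStacking 1 (Real.sqrt (2 / 3)) =
      (fun q => A₁ q + t₂) '' fccStacking 1 (Real.sqrt (2 / 3)) := by
    have e2 : (fun q => A₂ q + t₂) '' fccStacking 1 (Real.sqrt (2 / 3)) =
        (fun y => y + t₂) '' (A₂ '' fccStacking 1 (Real.sqrt (2 / 3))) := by rw [Set.image_image]
    have e1 : (fun q => A₁ q + t₂) '' fccStacking 1 (Real.sqrt (2 / 3)) =
        (fun y => y + t₂) '' (A₁ '' fccStacking 1 (Real.sqrt (2 / 3))) := by rw [Set.image_image]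
    rw [e2, e1, htrans]
  -- genericity in the cell's form
  have hgen' : ∀ k : ℕ, ∀ q ∈ fccStacking 1 (Real.sqrt (2 / 3)), ((3 : ℝ) ^ k) • (t₂ - t₁) ≠ A₁ q := by
    intro k q hq heq
    apply hgen k
    have : ((3 : ℝ) ^ k) • A₁.symm (t₂ - t₁) = q := by
      apply A₁.injective
      rw [LinearIsometryEquiv.map_smul, A₁.apply_symm_apply, heq]
    rw [this]; exact hq
  -- the steepest slot as the root
  obtain ⟨u, huS, hu2⟩ := exists_slot_rise_ge A₁
  have hs2 : 0 < Real.sqrt 2 := by positivity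
  have hα : 0 < (A₁ u) 2 := lt_of_lt_of_le (by positivity) hu2
  have hflux : 1 ≤ Real.sqrt 2 * (A₁ u) 2 := by
    have := mul_le_mul_of_nonneg_left hu2 hs2.le
    rw [mul_one_div, div_self hs2.ne'] at this
    exact this
  set K : ℝ := 12 * Real.sqrt 2 * Real.pi + 36 * 10 + 55440 with hKdef
  have hK0 : 0 ≤ K := by positivity
  obtain ⟨C, hC⟩ := twoSlab_cross_le_of_deficit A₁ t₁ A₂ t₂ 10 le_rfl
  refine ⟨C + K / 2, 10, by norm_num, ?_⟩
  intro h hh ρ hρ X P₁ P₂ hX hP₁X hP₂X₁ hcyl hP₁ hP₂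
  have hP₂X : P₂ ⊆ X := hP₂X₁.trans sdiff_subset
  have hρ0 : (0 : ℝ) ≤ ρ := by linarith
  have hP₂' : ∀ p, p ∈ P₂ ↔ (p ∈ (fun q => A₁ q + t₂) '' fccStacking 1 (Real.sqrt (2 / 3)) ∧
      h + 10 ≤ p 2 ∧ p 2 ≤ h + 2 * 10 ∧ p 0 ^ 2 + p 1 ^ 2 ≤ ρ ^ 2) := by
    intro p; rw [hP₂, hΛ₂]
  have hcell := wordNet_trans_payers_ge_generic_sharp hg hδ0 hδ hK hs₀ hcert hcertA A₁ huS hα t₁ t₂ X P₁ P₂ 10 h ρ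
    le_rfl hh hρ hX hcyl hP₁X hP₂X hP₁ hP₂' hgen'
  rw [← hKdef] at hcell
  have hpay : 1 * Real.pi * ρ ^ 2 - K * (1 + h) * ρ ≤
      ∑ z ∈ X.filter (fun z => -(10 : ℝ) - 2 ≤ z 2 ∧ z 2 ≤ h + 10 + 2),
        ((12 : ℝ) - ((X.filter fun q => dist z q = 1).card : ℝ)) := by
    have hKh : K * ρ ≤ K * (1 + h) * ρ := by
      have := mul_nonneg (mul_nonneg hK0 hh) hρ0; linarith only [this]
    have hπρ : 0 ≤ Real.pi * ρ ^ 2 := by positivity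
    have hfl : 1 * (Real.pi * ρ ^ 2) ≤ Real.sqrt 2 * (A₁ u) 2 * (Real.pi * ρ ^ 2) :=
      mul_le_mul_of_nonneg_right hflux hπρ
    have e2 : Real.sqrt 2 * (A₁ u) 2 * Real.pi * ρ ^ 2 = Real.sqrt 2 * (A₁ u) 2 * (Real.pi * ρ ^ 2) := by ring
    rw [e2] at hcell
    have e3 : 1 * Real.pi * ρ ^ 2 = 1 * (Real.pi * ρ ^ 2) := by ring
    rw [e3]
    linarith only [hcell, hKh, hfl]
  have key := hC h hh ρ hρ X P₁ P₂ hX hP₁X hP₂X₁ hcyl hP₁ hP₂ 1 K hK0 hpay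
  exact key

end Exact

end Summit.Ventures.Crystal3D.Theorems

end
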